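import Mathlib
import Literature.MathematicalPhysics.QuantumFieldTheory.OSSectorContinuation
import Literature.MathematicalPhysics.QuantumFieldTheory.OSReconstructionNoE1Proofs
import Literature.MathematicalPhysics.QuantumFieldTheory.OSJointSpectralMeasureUniqueness
import Summits.QuantumFields.YangMills.Theorems.MirrorModularBoostsPlanarSpectralConeSpanLinearity
import HarnessLib

/-!
# Null sets of joint spectral measures pass to the closed span (stub `stub_linearity`, crux `PlanarSpectralCone`)

Line `two-mirror-lightcone-slots` of crux `MirrorModularBoosts.PlanarSpectralCone`
(stmt-QuantumFields-9664), CLOSURE step.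

Informal statement. Let `S` be a labelled Schwinger family on `ℝ^d` (`d ≥ 1`, any labels) with
reflection positivity and translation invariance on `⁰𝒮`, and `h : OSReconstructionNoE1 S` its
Osterwalder–Schrader reconstruction (Hilbert space `ℋ`, `e^{-tH} = h.transfer t`, `U(a⃗) = h.translate a`,
joint spectral measures `h.IsJointSpectralMeasure ψ μ` of `(H, P⃗)`). If a set `N` of energy–momentum
space is null for every joint spectral measure of every vector of a set `D ⊆ ℋ` whose linear span is
dense, then `N` is null for every joint spectral measure of every vector of `ℋ`.

This is, verbatim, the CLOSURE stub shared with line `positivity-disc-to-operator-cone` of the same crux,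
already in the tree as
`Summit.QuantumFields.YangMills.Cruxes.PlanarSpectralCone.PositivityDiscToOperatorCone.stub_linearity`
(`Theorems/MirrorModularBoostsPlanarSpectralConeSpanLinearity.lean`); this file is the one-line alias in
the namespace of line `two-mirror-lightcone-slots`, as its skeleton requires.

Proof (of the aliased theorem). Joint spectral measures exist
(`OSReconstructionNoE1.exists_isJointSpectralMeasure_holds`) and are unique
(`OSReconstructionNoE1.IsJointSpectralMeasure.unique`: Laplace–Fourier uniqueness of finite measures on
`{p₀ ≥ 0}`, tree file `Literature/…/OSJointSpectralMeasureUniqueness.lean`), and AS MEASURES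
`μ_{φ₁+φ₂} + μ_{φ₁−φ₂} = 2(μ_{φ₁} + μ_{φ₂})` (`IsJointSpectralMeasure.add_parallelogram`) and
`μ_{cφ} = |c|² μ_φ` (`IsJointSpectralMeasure.eq_smul`); hence `V = {φ | μ_φ(N) = 0}` is a linear
subspace, closed because `μ_φ(N) ≤ 2μ_θ(N) + 2‖φ − θ‖²` (`IsJointSpectralMeasure.measure_univ`),
containing `D`, hence all of `ℋ = closure (span D)`; the given `μ` is `μ_ψ` by uniqueness. The
measurability hypothesis `hN` is not used (kept for the registered signature).

References: M. Reed, B. Simon, Methods of Modern Mathematical Physics I, Thm. VIII.12 (joint spectral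
measures); K. Osterwalder, R. Schrader, Comm. Math. Phys. 31 (1973), §4.1 (`e^{-tH}`, `U(a⃗)`); the
rest is folklore (spectral subspaces are closed subspaces).
-/

noncomputable section

namespace Summit.QuantumFields.YangMills.Cruxes.PlanarSpectralCone.TwoMirrorLightconeSlots

open MeasureTheory Complex Set Filter
open scoped InnerProductSpace ComplexConjugate
open Literature.MathematicalPhysics.QuantumLattice Literature.MathematicalPhysics.AQFT
  Literature.MathematicalPhysics.QuantumFieldTheory

/-- **CLOSURE / LINEARITY — null sets of joint spectral measures pass to the closed span.** For ANY
labelled family with E2 and translation invariance on `⁰𝒮` (any labels, any dimension `d ≥ 1`), a set `N`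
of energy–momentum space that is null for every joint spectral measure of every vector of a set `D` of
dense linear span is null for every joint spectral measure of every vector. Alias, in this line's
namespace, of `PositivityDiscToOperatorCone.stub_linearity` (existence + Laplace–Fourier uniqueness of
joint spectral measures ⇒ parallelogram/scaling laws as measures ⇒ `{φ | μ_φ(N) = 0}` is a closed
submodule ⊇ `D`). The measurability hypothesis `hN` is not needed. -/
theorem stub_linearity {ι : Type*} {d : ℕ} [NeZero d]
    {S : LabelledSchwingerFamily ι (EuclideanSpace ℝ (Fin d))} (h : OSReconstructionNoE1 S)
    {N : Set (EuclideanSpace ℝ (Fin d))} (hN : MeasurableSet N) {D : Set h.Hilbert}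
    (hD : Dense ((Submodule.span ℂ D : Submodule ℂ h.Hilbert) : Set h.Hilbert))
    (hDN : ∀ ψ ∈ D, ∀ μ : Measure (EuclideanSpace ℝ (Fin d)), h.IsJointSpectralMeasure ψ μ → μ N = 0)
    (ψ : h.Hilbert) (μ : Measure (EuclideanSpace ℝ (Fin d))) (hμ : h.IsJointSpectralMeasure ψ μ) :
    μ N = 0 :=
  _root_.Summit.QuantumFields.YangMills.Cruxes.PlanarSpectralCone.PositivityDiscToOperatorCone.stub_linearity
    h hN hD hDN ψ μ hμ

end Summit.QuantumFields.YangMills.Cruxes.PlanarSpectralCone.TwoMirrorLightconeSlots
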